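import Mathlib
import HarnessLib
import HarnessLib.Audit
import Summits.AtomisticToContinuum.Statement

/-!
Route: ZeroPressureMagicLadder

CLOSED (retired) 2026-08-15T13:47:43Z by operator:999:1257524 — reason: not-a-thesis: assembly does not conclude the sub-problem Statement — note: D-0027 §2.1 audit (human 2026-08-15: routes that do not decide the summit are removed): the assembly concludes `Literature.MathematicalPhysics.StatisticalMechanics.Crystallization`, not the sub-problem statement; a NEW conforming route may be opened from the same idea (generated `closes : … → _root_. The file is kept as the record of this route; refuted decls are indexed as negative knowledge (`ledger negatives`).

# Route ZeroPressureMagicLadder — zero-pressure magic functions for Lennard-Jones — pair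
certificates at equilibrium density on the ladder d = 1 (explicit), 8 (CKMRV), 3 (summit)

It suffices to show X = X₃ ∧ R₃ for V = V_LJ = r⁻¹²/12 − r⁻⁶/6 in ℝ³. X₃ (ZERO-PRESSURE MAGIC
FUNCTION): there is a
continuous positive-definite g : ℝ³ → ℝ (all finite quadratic forms Σ cᵢcⱼ g(xᵢ − xⱼ) ≥ 0) with g(x)
≤ V(|x|) for
x ≠ 0 whose value −g(0)/2 is ATTAINED by a periodic configuration P: e(P) = −g(0)/2. Since Σ_{i<j} V
≥ Σ_{i<j} g ≥
−N g(0)/2 for every N-point configuration (Fisher–Ruelle / Cohn–Kumar, no density term), X₃ gives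
E(N) ≥ N e(P),
e(Q) ≥ e(P) for every periodic Q, hence conjunct (i) with the trial-state upper bound. R₃
(CERTIFICATE RIGIDITY): a
tight certificate pins pair distances to {g = V} and the structure factor to {ĝ = 0}, and this
forces conjunct (ii).
Card realised: zero-pressure-magic-function-dimension-ladder (with the merged delta
e8-zero-pressure-interpolated-
certificate); the d = 1 and d = 8 rungs are ranked cruxes that decide whether X₃ is alive and are
theorems on their own.
Lean: `(∃ g : EuclideanSpace ℝ (Fin 3) → ℝ, Continuous g ∧ (∀ (n : ℕ) (x : Fin n → EuclideanSpace ℝ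
(Fin 3)) (c : Fin n → ℝ), 0 ≤ ∑ i, ∑ j, c i * c j * g (x i - x j)) ∧ (∀ x : EuclideanSpace ℝ (Fin
3), x ≠ 0 → g x ≤ Literature.MathematicalPhysics.StatisticalMechanics.lennardJones ‖x‖) ∧ ∃ P :
Literature.MathematicalPhysics.StatisticalMechanics.PeriodicConfiguration 3, P.energyPerParticle
Literature.MathematicalPhysics.StatisticalMechanics.lennardJones = -(g 0) / 2) ∧
CertificateRigidity3`

## Assembly
Bookkeeping only: from MagicFunctionLJ3 take (g, P); PeriodicBochnerBound3 makes e(P) = −g(0)/2 the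
least periodic
value (IsLeast, checked sorry-free in Sketch.lean); FiniteBochnerBound3 gives E(N)/N ≥ e(P) for N ≥
1 (le_ciInf over
injective configurations) and CrysEnergyUpper gives limsup ≤ ⨅ = e(P), so E(N)/N → e(P):
HasPeriodicGroundStateEnergy.
CertificateRigidity3 applied to (g, P) gives IsCrystallizing; the pair is Literature…Crystallization
(= the sub-problem
abbrev Crystallization). LineLitmus and E8Rung are not antecedents: they are the ladder
(kill/steer), not load-bearing.

Rationale: WHY THIS LINE. The two-point Fourier bound is the only device that has ever proved an
energy-minimisation theorem among ALL periodic
configurations in d ≥ 2 (CohnEtAl2019 Thm 4, d = 8, 24, completely monotone p, FIXED density;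
Viazovska2017), and
its ZERO-PRESSURE form E(N) ≥ −N g(0)/2 is exactly the shape of conjunct (i) (free clusters sit at
zero pressure;
Ruelle1969 Prop. 3.2.7). For a DIFFERENCE of completely monotone functions such as V_LJ nothing
transfers from
CKMRV — but the interpolation constructions are LINEAR in the potential, and at the equilibrium
scale the
stationarity Σ_k k·Ṽ′(k) = 0 makes the interpolated candidate automatically tight (∫g = ĝ(0) = 0,
g(0) = −2e*), so
sharpness reduces to two sign checks on one explicit function. This unit ran the d = 1 check:
Cohn–Kumar's band-
limited Hermite interpolant (CohnKumar2006 §9, Prop. 34 of arXiv:math/0607446) applied to Ṽ(x) =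
V_LJ(a*x),
a* = (ζ(12)/ζ(6))^{1/6}, satisfies ĥ ≥ 0 on [−1,1] and h ≤ Ṽ off 0 numerically to 1e-13 with
strictly positive
second-order contact at every node (compute/ck1d_lj*.py; § Numbers) — the litmus the card posed
comes out SHARP,
which is new evidence that pair-positivity does see Lennard-Jones crystallization. Imported:
Fourier/LP duality and
modular-form interpolation (sphere packing), Fisher–Ruelle stability (statistical mechanics),
Lev–Olevskii
crystalline-measure rigidity (harmonic analysis) for R₃. No prior route on this summit uses a dual
certificate.

RANKED CRUXES. #2 MagicFunctionLJ3 (crux) — X₃ — a continuous positive-definite minorant g of V_LJ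
on ℝ³∖{0} whose zero-pressure bound −g(0)/2 is attained by a periodic configuration (card
M-assembly; expected P = relaxed hcp, e(P) ≈ −0.7175). [difficulty: open-problem] (why it might
fail: d = 3 has no interpolation basis and the two-point program is NOT sharp for packing there
(Li2022: 0.18398 > 0.17678); a phantom PD pair measure with ≈ 13.4 'neighbours' in the well
(polytetrahedral statistics) may beat hcp's 12 — one Li-type Dirac comb with ½∫V dγ < e(hcp) refutes
it.) [Li2022, CohnKumar2006, CohnLaatSalmon2022, Yuhjtman2015, DelimaProcacciYuhjtman2015,
BlancLewin2015]
#3 LineLitmus (crux) — d = 1 LITMUS (card M2): the zero-pressure two-point bound is sharp for the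
Lennard-Jones chain — a continuous positive-definite g : ℝ → ℝ with g ≤ V_LJ(|x|) off 0 and g(0) =
−2 Σ_{k≥1} V_LJ(ak) for some a > 0 (then a = a*, −g(0)/2 = e₁* = −ζ(6)²/(12ζ(12)) = min over
periodic configurations; candidate: the Cohn–Kumar interpolant of Ṽ, verified numerically in this
unit). [difficulty: M] (why it might fail: only numerics so far: the margins are thin exactly where
it matters (Ṽ − h = 4.7e-3 at x = 1.05; ĥ ~ 2.96(1−t)³ at t → 1, third-order vanishing), so a
certified evaluation could still find a sign change; and CK's candidate is not unique in d = 1, so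
its failure would not even settle the litmus.) [CohnKumar2006, VentevogelNijboer1979,
Ventevogel1978, GardnerRadin1979, NijboerRuijgrok1985, BlancLewin2015]
#4 E8Rung (crux) — d = 8 RUNG (card M3 + merged T1–T3): for the Mie potential V₁₂(r) = r⁻²⁴/24 −
r⁻¹²/12 on ℝ⁸ (exponents > 8 so lattice sums converge) a continuous positive-definite minorant g
exists whose zero-pressure bound is attained by a periodic configuration (expected: E₈ at its
equilibrium scale; candidate forced by CKMRV Thm 7/9: g = Σ_n p(√2n)aₙ + p′(√2n)bₙ with p =
V₁₂(s*·), automatically ∫g = 0). [difficulty: XL] (why it might fail: the CKMRV candidate is the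
ONLY radial-Schwartz-type tight function (Thm 9); for the signed Bernstein measure of r⁻²⁴/24 −
r⁻¹²/12, p − g ≥ 0 between E₈ shells or ĝ ≥ 0 near the first dual shell can fail; E₈ for LJ-type
exponents is open even among lattices (BeterminPetrache2019).) [CohnEtAl2019, Viazovska2017,
BeterminPetrache2019, CohnKumar2006]
#5 CertificateRigidity3 (crux) — R₃ (card M4): any tight zero-pressure pair certificate (g, P) for
V_LJ in ℝ³ forces positional crystallization: ground states x^N have Σ_{i<j}(V − g̃)(xᵢ − xⱼ) = o(N)
(pair distances pinned to the contact set {g = V}) and ∫ |Σ_j e^{2πik·x_j}|² dĝ(k) = o(N) (structure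
factor pinned to {ĝ = 0}, which sees stacking order through the diffuse rods), whence local
convergence along subsequences, up to translations, to a non-zero periodic point measure
(CKMRV-§uniqueness / Lev–Olevskii-type rigidity). [deps: MagicFunctionLJ3] [difficulty: L] (why it
might fail: a tight g may be DEGENERATE (contact set or spectral zero set not uniformly discrete,
Sütő-type), leaving stacking-disordered or incommensurate near-minimisers unpunished; Lev–Olevskii
rigidity needs uniform discreteness on both sides; vacuous if MagicFunctionLJ3 is refuted first.)
[LevOlevskii2014, CohnEtAl2019, SutoPRL2005, BlancLewin2015, GardnerRadin1979]
#9 FiniteBochnerBound3 (support) — the finite zero-pressure bound (Fisher–Ruelle positive-type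
estimate): for a positive-definite g with g ≤ V_LJ off 0 in ℝ³ and every injective N-point
configuration, Σ_{i<j} V_LJ ≥ −N g(0)/2 (take c ≡ 1 in the quadratic form; the symmetrised
g(x)+g(−x) ≤ 2V handles non-even g). [difficulty: provable-now] [Ruelle1969, CohnKumar2006]
#9 PeriodicBochnerBound3 (support) — the periodic zero-pressure bound: for such g and every periodic
configuration Q of ℝ³, −g(0)/2 ≤ e_LJ(Q) (finite blocks of Q + FiniteBochnerBound3 + the r⁻⁶
summability of PeriodicConfigurationSums; equivalently Cohn–Kumar Prop. 31 at zero pressure, no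
Poisson summation needed). [difficulty: M] [CohnKumar2006, BlancLewin2015]
#9 CrysEnergyUpper (support) — trial-state upper bound limsup E(N)/N ≤ inf over periodic
configurations of e_LJ (finite blocks of a near-optimal periodic Q, boundary O(N^{2/3}); shared with
CrystalLocalRigidity item 0629, same signature). [difficulty: M] [BlancLewin2015, Theil2006]

TWO-LAYER PLAN. Foreseen glued splits (none filed now): LineLitmus ⇐ LineCandidateMinorant (h_CK ≤ Ṽ
off 0, certified series
evaluation + node/endpoint/infinity asymptotics) → LineCandidateFourierPositive (ĥ_CK ≥ 0 on [0,1])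
→ LineLitmus (glue:
CK identities h(k) = Ṽ(k), supp ĥ ⊆ [−1,1], Bochner, Σ kṼ′(k) = 0); E8Rung ⇐ E8CandidateMinorant →
E8CandidateFourierPositive
→ E8Rung (glue: CKMRV Thm 7 as a cited fact + Poisson over E₈ + ĝ(0) = −e′(1)/4 = 0);
CertificateRigidity3 ⇐ SlacknessPinning
(excess energy = contact defect + spectral defect, both o(N)) → BraggRigidity (uniformly discrete
support and spectrum ⇒
periodic limit) → CertificateRigidity3; MagicFunctionLJ3 ⇐ LP value λ₃ = |e(hcp)| (certified
bracket) → explicit construction.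

KILL CRITERIA. MagicFunctionLJ3 refuted (one explicit PD phantom pair measure — e.g. a Li-type Dirac
comb ν ≥ 0, ν̂ ≥ 0 on ℤ_m³ —
with ½∫V_LJ dγ < e(hcp) ≈ −0.7175; card phantom-pair-measures-lp-gap is set up to produce it) closes
the route
`refuted:MagicFunctionLJ3`; LineLitmus/E8Rung survive as shared statements (ladder harvest) and the
measured gap becomes
the barrier fact LennardJones_twoPointNotSharp3D. E8Rung refuted (the unique CKMRV candidate changes
sign) ⇒ the thesis
"interpolation gives LJ-type at zero pressure" is false above d = 1 ⇒ close `exhausted` unless a d =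
3 LP bracket says
otherwise. LineLitmus refuted by a certified 1-D gap would contradict this unit's numerics —
recheck, then close.
CrysPeriodicMinAttained (0627) refuted elsewhere kills the conjunct and every positive route.

NOT DECOMPOSED YET. The d = 2 rung (triangular lattice for (12,6) among ALL periodic configurations
of ℝ² — no interpolation basis; numerics
first), the whole exponent family (2q, q), q > 8, in d = 8 and the Leech rung; the identification P
= E₈ / P = hcp inside
the existential cruxes; interval-arithmetic constants for the d = 1 certificate; the form of
BraggRigidity (Lev–Olevskii vs
CKMRV §6 uniqueness argument); Poisson summation over general lattices in Mathlib (only d = 1 is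
available) — all layer-2.

CHEAPEST FALSIFIER. Run first (refuters): the zero-pressure primal/dual LP for V_LJ in ℝ³ — radial h
on a spline grid with exact −τ r⁻⁶ tail,
ĥ ≥ 0 on a k-grid (primal) against Li-type rational Dirac-comb phantoms (dual) — and compare sup
−h(0)/2 with e(hcp) =
−0.7175: a certified dual value below e(hcp) kills MagicFunctionLJ3 in hours. Already run in this
unit (d = 1,
compute/ck1d_lj.py + ck1d_lj_check2.py, pure python): the Cohn–Kumar candidate for Ṽ = V_LJ(a*·)
passes both sign checks
(min ĥ = +9e-23 at t = 1, min(Ṽ − h) = +1e-13 off nodes on (0, 60), (Ṽ − h)″(k) > 0 for k = 1..40);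
controls: f = x⁻¹²
passes (CK theorem), V_LJ at a = 1.01a* fails at t = 0 (ĥ(0) = −0.113) as the zero-pressure identity
predicts.

NUMBERS. d = 1: a* = (ζ(12)/ζ(6))^{1/6} = 0.997179264; e₁* = Σ_{k≥1}V(a*k) = −ζ(6)²/(12ζ(12)) =
−0.086227689; h(0) = 0.172455379 = −2e₁*;
ĥ(0) = −2Σ_k kṼ′(k) = 0 (7e-15); ĥ ≈ −4π²(Σk²Ṽ(k)) t² = 3.84 t² at 0 and ≈ [−4π²Σk²Ṽ(k) −
(4π²/3)Σk³Ṽ′(k)](1−t)³ = 2.96(1−t)³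
at 1; binding primal margin Ṽ − h = 4.7e-3 at x = 1.05; tail h ≈ −0.048 sin²(πx)/x⁴ < Ṽ ≈
−x⁻⁶/(6a*⁶). d = 3 (tree units,
V = r⁻¹²/12 − r⁻⁶/6 = BL/12): e(hcp) ≈ −0.7175 < e(fcc) by ≈ 1e-4 relative; rigorous stability
constant 0.7175 ≤ B_LJ ≤ 1.193
(8.61 ≤ 12B ≤ 14.316, Yuhjtman2015, DelimaProcacciYuhjtman2015); packing analogue: two-point dual
bound 0.18398 vs δ₃ = 0.17678
(Li2022, 4.1 % gap). d = 8: E₈ min norm √2 at covolume 1; CKMRV interpolation nodes √(2n), n ≥ 1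
(CohnEtAl2019 Thm 7, n₀ = 1).
Items at open: 8 (4 cruxes, 3 support, 1 assembly).

DEFINITION REQUESTS. None needed to type the items (positive-definiteness is inlined as finite
quadratic forms). Cite-facts wanted for provers
of E8Rung: CKMRV interpolation formula and isomorphism (CohnEtAl2019 Thm 7 and Thm 9, (d, n₀) = (8,
1)) and Viazovska's
E₈ facts (Viazovska2017) as named Literature Props; for LineLitmus nothing beyond Mathlib
(Real.tsum_eq_tsum_fourierIntegral,
Bochner via quadratic forms) is required.

Novelty: Searches (2026-08-15): lit frontier AtomisticToContinuum --since 2020 (30 rows; crystallization rows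
arXiv:2407.20762,
2604.19239 — real-space methods, no LP); lit bridges --cross any (30 rows, none on energy LP
bounds); lit search --hybrid
"linear programming bound energy Lennard-Jones positive definite minorant zero pressure" (15 book
hits; only Ruelle1969 p.39
relevant); crossref "Ventevogel Nijboer minimum potential energy per particle" (found
Ventevogel1978, VentevogelNijboer1979 ×2,
NijboerRuijgrok1985 ×2; VN1979-II paywalled → acq-02290); zbMATH three queries (0 rows); s2/arXiv
rate-limited; lit galaxy
search "minimum potential energy per particle" --star all and "universally optimal" --star pdf
(noise only); full reads:
CohnKumar2006 §9 (Props 31, 34, Conj 32, pp. 24–30 of arXiv:math/0607446), CohnEtAl2019 §1 (Thms 4,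
7, 9, eq. (1.5)),
BlancLewin2015 §2.3 (d = 1 status), the card, its retired child and the refuter audits.
Nearest prior art found: CohnKumar2006 Prop. 34 (arXiv numbering) — the band-limited interpolant
proves the LP bound sharp
for ℤ for COMPLETELY MONOTONE f at FIXED density ("it is not obvious that Proposition 31 proves a
sharp bound even in this
trivial case"); Ruelle1969 Prop. 3.2.7 / Fisher–Ruelle (positive-type stability bound = the
zero-pressure two-point value,
never optimised); CohnEtAl2019 eq. (1.5) + Thm 9 (forced candidate in d = 8, CM p, fixed density);
BeterminPetrache2019
(E₈ for LJ-type exponents among lattices only, large exponents); Li  [refs: 2407.20762, math/0607446, Ruelle1969, Ventevogel1978, VentevogelNijboer1979, NijboerRuijgrok1985, CohnKumar2006, CohnEtAl2019, BlancLewin2015, BeterminPetrache2019, Li2022]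

Barriers (technique_class: two-point-fourier-lp zero-pressure interpolation-basis): - technique_class: two-point-fourier-lp zero-pressure interpolation-basis
- Literature.Barriers.AtomisticToContinuum.Li2022_cohnElkies3D: APPLIES by analogy to
MagicFunctionLJ3 (same technique class, d = 3) but decides nothing for the (12,6) energy at zero
pressure (its own audit: "a finite-dimensional computation away … not done in print"); it does not
apply to LineLitmus / E8Rung (d = 1, 8 are the sharp dimensions). The bet is declared weak in d = 3
and the refutation is cheap — that is the point of ranking it 2.
- Literature.Barriers.AtomisticToContinuum.NoUniversallyOptimalLattice3D: not engaged — one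
potential at its own equilibrium scale, no universal optimality claimed; in d = 8 universal
optimality holds and is shown insufficient (fixed density, CM only), which is why E8Rung is a crux
and not a citation.
- Literature.Barriers.AtomisticToContinuum.SutoDegenerateGroundStates: the degenerate face of
Fourier certificates; CertificateRigidity3 must exclude it (a tight g for V_LJ is expected to have
isolated double zeros of V − g on P's distance set and of ĝ on P's Bragg set, unlike Sütő's
band-limited V = g); named as that crux's failure mode.
- Literature.Barriers.AtomisticToContinuum.HcpNotBravais: the d = 3 certificate must be tight on a
lattice-plus-motif set (extinctions in the Bragg set); the bounds (Cohn–Kumar Prop. 31, block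
argument) hold for all periodic configurations, so only the CONSTRUCTION of g is affected — absent
in d = 1, 8 where the minimisers are lattic

History (route lifecycle, newest last):
- 2026-08-15T13:47:43Z · CLOSED retired — not-a-thesis: assembly does not conclude the sub-problem Statement (operator:999:1257524)

sub-problem: Crystallization · status: closed(retired) · opened planner-plancard-AtomisticToContinuum-Crystal-dc42983b-0 2026-08-15T11:26:22Z · rev 0 · ledger route-AtomisticToContinuum-ZeroPressureMagicLadder
GENERATED by the gate from the ledger (D-0016/17). Provers cite these decls: `theorem foo : Summit.AtomisticToContinuum.Crystallization.Theses.ZeroPressureMagicLadder.<Decl> := …` in Summits/AtomisticToContinuum/Crystallization/Theorems/<Name>.lean.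
-/

namespace Summit.AtomisticToContinuum.Crystallization.Theses.ZeroPressureMagicLadder

open scoped BigOperators Topology Manifold Classical MeasureTheory ProbabilityTheory Matrix InnerProductSpace ComplexConjugate ContinuousMap
open Filter Set Function TopologicalSpace MeasureTheory

attribute [summit_statement] _root_.Crystallization

/-- item stmt-AtomisticToContinuum-3955 · crux · rank 2 · closed · moot by None · by planner
why it might fail: d = 3 has no interpolation basis and the two-point program is NOT sharp for packing there (Li2022: 0.18398 > 0.17678); a phantom PD pair measure with ≈ 13.4 'neighbours' in the well (polytetrahedral statistics) may beat hcp's 12 — one Li-type Dirac comb with ½∫V dγ < e(hcp) refutes it.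
sources: Li2022, CohnKumar2006, CohnLaatSalmon2022, Yuhjtman2015, DelimaProcacciYuhjtman2015, BlancLewin2015
[crux] X₃ — a continuous positive-definite minorant g of V_LJ on ℝ³∖{0} whose zero-pressure bound
−g(0)/2 is attained by a periodic configuration (card M-assembly; expected P = relaxed hcp, e(P) ≈
−0.7175). [difficulty: open-problem] -/
@[route_item "route-AtomisticToContinuum-ZeroPressureMagicLadder"]
def MagicFunctionLJ3 : Prop :=
  ∃ g : EuclideanSpace ℝ (Fin 3) → ℝ, Continuous g ∧ (∀ (n : ℕ) (x : Fin n → EuclideanSpace ℝ (Fin 3)) (c : Fin n → ℝ), 0 ≤ ∑ i, ∑ j, c i * c j * g (x i - x j)) ∧ (∀ x : EuclideanSpace ℝ (Fin 3), x ≠ 0 → g x ≤ Literature.MathematicalPhysics.StatisticalMechanics.lennardJones ‖x‖) ∧ ∃ P : Literature.MathematicalPhysics.StatisticalMechanics.PeriodicConfiguration 3, P.energyPerParticle Literature.MathematicalPhysics.StatisticalMechanics.lennardJones = -(g 0) / 2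

/-- item stmt-AtomisticToContinuum-3956 · crux · rank 3 · closed · moot by None · by planner
why it might fail: only numerics so far: the margins are thin exactly where it matters (Ṽ − h = 4.7e-3 at x = 1.05; ĥ ~ 2.96(1−t)³ at t → 1, third-order vanishing), so a certified evaluation could still find a sign change; and CK's candidate is not unique in d = 1, so its failure would not even settle the litmus.
sources: CohnKumar2006, VentevogelNijboer1979, Ventevogel1978, GardnerRadin1979, NijboerRuijgrok1985, BlancLewin2015
[crux] d = 1 LITMUS (card M2): the zero-pressure two-point bound is sharp for the Lennard-Jones
chain — a continuous positive-definite g : ℝ → ℝ with g ≤ V_LJ(|x|) off 0 and g(0) = −2 Σ_{k≥1}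
V_LJ(ak) for some a > 0 (then a = a*, −g(0)/2 = e₁* = −ζ(6)²/(12ζ(12)) = min over periodic
configurations; candidate: the Cohn–Kumar interpolant of Ṽ, verified numerically in this unit).
[difficulty: M] -/
@[route_item "route-AtomisticToContinuum-ZeroPressureMagicLadder"]
def LineLitmus : Prop :=
  ∃ (g : ℝ → ℝ) (a : ℝ), 0 < a ∧ Continuous g ∧ (∀ (n : ℕ) (x : Fin n → ℝ) (c : Fin n → ℝ), 0 ≤ ∑ i, ∑ j, c i * c j * g (x i - x j)) ∧ (∀ x : ℝ, x ≠ 0 → g x ≤ Literature.MathematicalPhysics.StatisticalMechanics.lennardJones |x|) ∧ g 0 = -2 * ∑' k : ℕ, Literature.MathematicalPhysics.StatisticalMechanics.lennardJones (a * ((k : ℝ) + 1))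

/-- item stmt-AtomisticToContinuum-3957 · crux · rank 4 · closed · moot by None · by planner
why it might fail: the CKMRV candidate is the ONLY radial-Schwartz-type tight function (Thm 9); for the signed Bernstein measure of r⁻²⁴/24 − r⁻¹²/12, p − g ≥ 0 between E₈ shells or ĝ ≥ 0 near the first dual shell can fail; E₈ for LJ-type exponents is open even among lattices (BeterminPetrache2019).
sources: CohnEtAl2019, Viazovska2017, BeterminPetrache2019, CohnKumar2006
[crux] d = 8 RUNG (card M3 + merged T1–T3): for the Mie potential V₁₂(r) = r⁻²⁴/24 − r⁻¹²/12 on ℝ⁸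
(exponents > 8 so lattice sums converge) a continuous positive-definite minorant g exists whose
zero-pressure bound is attained by a periodic configuration (expected: E₈ at its equilibrium scale;
candidate forced by CKMRV Thm 7/9: g = Σ_n p(√2n)aₙ + p′(√2n)bₙ with p = V₁₂(s*·), automatically ∫g
= 0). [difficulty: XL] -/
@[route_item "route-AtomisticToContinuum-ZeroPressureMagicLadder"]
def E8Rung : Prop :=
  ∃ g : EuclideanSpace ℝ (Fin 8) → ℝ, Continuous g ∧ (∀ (n : ℕ) (x : Fin n → EuclideanSpace ℝ (Fin 8)) (c : Fin n → ℝ), 0 ≤ ∑ i, ∑ j, c i * c j * g (x i - x j)) ∧ (∀ x : EuclideanSpace ℝ (Fin 8), x ≠ 0 → g x ≤ (1 / 24) * (‖x‖⁻¹) ^ 24 - (1 / 12) * (‖x‖⁻¹) ^ 12) ∧ ∃ P : Literature.MathematicalPhysics.StatisticalMechanics.PeriodicConfiguration 8, P.energyPerParticle (fun r : ℝ => (1 / 24) * (r⁻¹) ^ 24 - (1 / 12) * (r⁻¹) ^ 12) = -(g 0) / 2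

/-- item stmt-AtomisticToContinuum-3958 · crux · rank 5 · closed · moot by None · by planner
why it might fail: a tight g may be DEGENERATE (contact set or spectral zero set not uniformly discrete, Sütő-type), leaving stacking-disordered or incommensurate near-minimisers unpunished; Lev–Olevskii rigidity needs uniform discreteness on both sides; vacuous if MagicFunctionLJ3 is refuted first.
sources: LevOlevskii2014, CohnEtAl2019, SutoPRL2005, BlancLewin2015, GardnerRadin1979
[crux] R₃ (card M4): any tight zero-pressure pair certificate (g, P) for V_LJ in ℝ³ forces
positional crystallization: ground states x^N have Σ_{i<j}(V − g̃)(xᵢ − xⱼ) = o(N) (pair distances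
pinned to the contact set {g = V}) and ∫ |Σ_j e^{2πik·x_j}|² dĝ(k) = o(N) (structure factor pinned
to {ĝ = 0}, which sees stacking order through the diffuse rods), whence local convergence along
subsequences, up to translations, to a non-zero periodic point measure (CKMRV-§uniqueness /
Lev–Olevskii-type rigidity). [deps: MagicFunctionLJ3] [difficulty: L] -/
@[route_item "route-AtomisticToContinuum-ZeroPressureMagicLadder"]
def CertificateRigidity3 : Prop :=
  ∀ (g : EuclideanSpace ℝ (Fin 3) → ℝ) (P : Literature.MathematicalPhysics.StatisticalMechanics.PeriodicConfiguration 3), Continuous g → (∀ (n : ℕ) (x : Fin n → EuclideanSpace ℝ (Fin 3)) (c : Fin n → ℝ), 0 ≤ ∑ i, ∑ j, c i * c j * g (x i - x j)) → (∀ x : EuclideanSpace ℝ (Fin 3), x ≠ 0 → g x ≤ Literature.MathematicalPhysics.StatisticalMechanics.lennardJones ‖x‖) → P.energyPerParticle Literature.MathematicalPhysics.StatisticalMechanics.lennardJones = -(g 0) / 2 → Literature.MathematicalPhysics.StatisticalMechanics.IsCrystallizing Literature.MathematicalPhysics.StatisticalMechanics.lennardJones 3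

/-- item stmt-AtomisticToContinuum-0629 · support · rank 9 · closed · moot by None · by planner
sources: BlancLewin2015, Theil2006
Easy half of energetic crystallization: limsup E(N)/N ≤ ⨅ over periodic configurations of the LJ
energy per particle (finite blocks of a near-optimal periodic configuration as trial states;
boundary O(N^{2/3}); r⁻⁶ tail summable in d = 3; needs BddBelow of the range, from LJ stability). -/
@[route_item "route-AtomisticToContinuum-ZeroPressureMagicLadder"]
def CrysEnergyUpper : Prop :=
  Filter.limsup (fun N : ℕ => Literature.MathematicalPhysics.StatisticalMechanics.groundStateEnergy Literature.MathematicalPhysics.StatisticalMechanics.lennardJones 3 N / N) Filter.atTop ≤ ⨅ Q : Literature.MathematicalPhysics.StatisticalMechanics.PeriodicConfiguration 3, Q.energyPerParticle Literature.MathematicalPhysics.StatisticalMechanics.lennardJones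

/-- item stmt-AtomisticToContinuum-3959 · support · rank 9 · closed · moot by None · by planner
sources: Ruelle1969, CohnKumar2006
[support] the finite zero-pressure bound (Fisher–Ruelle positive-type estimate): for a
positive-definite g with g ≤ V_LJ off 0 in ℝ³ and every injective N-point configuration, Σ_{i<j}
V_LJ ≥ −N g(0)/2 (take c ≡ 1 in the quadratic form; the symmetrised g(x)+g(−x) ≤ 2V handles non-even
g). [difficulty: provable-now] -/
@[route_item "route-AtomisticToContinuum-ZeroPressureMagicLadder"]
def FiniteBochnerBound3 : Prop :=
  ∀ (g : EuclideanSpace ℝ (Fin 3) → ℝ), (∀ (n : ℕ) (x : Fin n → EuclideanSpace ℝ (Fin 3)) (c : Fin n → ℝ), 0 ≤ ∑ i, ∑ j, c i * c j * g (x i - x j)) → (∀ x : EuclideanSpace ℝ (Fin 3), x ≠ 0 → g x ≤ Literature.MathematicalPhysics.StatisticalMechanics.lennardJones ‖x‖) → ∀ (N : ℕ) (x : Fin N → EuclideanSpace ℝ (Fin 3)), Function.Injective x → -(g 0) / 2 * (N : ℝ) ≤ Literature.MathematicalPhysics.StatisticalMechanics.interactionEnergy Literature.MathematicalPhysics.StatisticalMechanics.lennardJones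 x

/-- item stmt-AtomisticToContinuum-3960 · support · rank 9 · closed · moot by None · by planner
sources: CohnKumar2006, BlancLewin2015
[support] the periodic zero-pressure bound: for such g and every periodic configuration Q of ℝ³,
−g(0)/2 ≤ e_LJ(Q) (finite blocks of Q + FiniteBochnerBound3 + the r⁻⁶ summability of
PeriodicConfigurationSums; equivalently Cohn–Kumar Prop. 31 at zero pressure, no Poisson summation
needed). [difficulty: M] -/
@[route_item "route-AtomisticToContinuum-ZeroPressureMagicLadder"]
def PeriodicBochnerBound3 : Prop :=
  ∀ (g : EuclideanSpace ℝ (Fin 3) → ℝ), (∀ (n : ℕ) (x : Fin n → EuclideanSpace ℝ (Fin 3)) (c : Fin n → ℝ), 0 ≤ ∑ i, ∑ j, c i * c j * g (x i - x j)) → (∀ x : EuclideanSpace ℝ (Fin 3), x ≠ 0 → g x ≤ Literature.MathematicalPhysics.StatisticalMechanics.lennardJones ‖x‖) → ∀ Q : Literature.MathematicalPhysics.StatisticalMechanics.PeriodicConfiguration 3, -(g 0) / 2 ≤ Q.energyPerParticle Literature.MathematicalPhysics.StatisticalMechanics.lennardJones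

/-- item stmt-AtomisticToContinuum-3961 · assembly · rank 1 · closed · moot by None · by planner
sources: BlancLewin2015, CohnKumar2006
[assembly] MagicFunctionLJ3 → FiniteBochnerBound3 → PeriodicBochnerBound3 → CrysEnergyUpper →
CertificateRigidity3 → Crystallization. -/
@[route_item "route-AtomisticToContinuum-ZeroPressureMagicLadder"]
def Assembly : Prop :=
  MagicFunctionLJ3 → FiniteBochnerBound3 → PeriodicBochnerBound3 → CrysEnergyUpper → CertificateRigidity3 → Literature.MathematicalPhysics.StatisticalMechanics.Crystallization

end Summit.AtomisticToContinuum.Crystallization.Theses.ZeroPressureMagicLadder
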